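import Summits.FinalStateConjecture.FinalStateConjecture.Theses.ZeroEnergyKerrOrBomb
import Literature.Geometry.Lorentzian.KillingModeStability
import Literature.Geometry.Lorentzian.EnergyCurrents
import Literature.Geometry.Lorentzian.Stationary
import Literature.Geometry.Lorentzian.Causality
import Literature.Geometry.Lorentzian.CompleteStationaryVacuumFlatProofs

/-!
# Sketch — crux-ideate `stmt-FinalStateConjecture-10689` (`KerrOrBomb`), round 1, ideator 2

First lemmas of the three crux idea cards (they must ELABORATE; proofs are not claimed, except
where given):

* card `aligned-sector-friedman-bomb`: `alignedSector_horizonFlux` (PROVED, pointwise algebra)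
  and the line target `NonRotatingStrictStationarity` (Prop);
* card `averaged-time-poincare-bendixson`: `AveragedCauchyHypersurface` (Prop);
* card `periodicity-from-the-collar`: `CommutingKillingPreservesNorm` (Prop, `mfderiv` form),
  `commutingKilling_mvfderiv_normSq_eq_zero` (its `mvfderiv` form, PROVED at the end of the file)
  and the line target `PeriodicityFromCollar` (Prop, with the residue `CollarLevelFlowCompact` as
  an explicit hypothesis).
-/

noncomputable section

namespace Summit.FinalStateConjecture.FinalStateConjecture.Cruxes.KerrOrBomb.Ideator2

open Set Literature.Geometry.Lorentzian
open scoped Manifold ContDiff Topology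

/-! ## Card A — aligned-sector Friedman bomb -/

section CardA

variable {E : Type*} [NormedAddCommGroup E] [NormedSpace ℝ E] {H : Type*} [TopologicalSpace H]
  {I : ModelWithCorners ℝ E H} {M : Type*} [TopologicalSpace M] [ChartedSpace H M]
  [IsManifold I ∞ M] {n : ℕ∞ω} [FiniteDimensional ℝ E]

/-- **Signed horizon flux in the aligned sector.** Pointwise algebra behind Friedman's
monotonicity on a Killing horizon: if the horizon generator is `K = T + Ω • Φ`, `K` is null and
`Φ ⊥ K` at `x` (both hold on a Killing horizon to which the axial field is tangent), then for a
field `ψ` with `Φψ = 0` at `x` the `T`-energy flux density through the horizon equals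
`T[ψ](T, K) = (Kψ)² ≥ 0`.  With `Ω = 0` (non-rotating branch `K ∈ ℝT`) the hypothesis `Φψ = 0`
is void.  Dafermos–Rodnianski arXiv:0811.0354 App. D; Friedman, CMP 63 (1978) 243, §2. -/
theorem alignedSector_horizonFlux
    (g : PseudoRiemannianMetric I n E (TangentSpace I : M → Type _)) (ψ : M → ℝ) (x : M)
    (T Φ K : TangentSpace I x) (Ω : ℝ) (hK : K = T + Ω • Φ) (hKK : g.val x K K = 0)
    (hΦK : g.val x Φ K = 0) (hΦψ : mvfderiv I ψ x Φ = 0) :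
    g.stressEnergy ψ x T K = (mvfderiv I ψ x K) ^ 2 := by
  have h1 : g.val x K K = g.val x T K + Ω * g.val x Φ K := by
    have := congrArg (fun v ↦ g.val x v K) hK
    simpa using this
  rw [hKK, hΦK, mul_zero, add_zero] at h1
  have hTK : g.val x T K = 0 := h1.symm
  have h2 : mvfderiv I ψ x K = mvfderiv I ψ x T + Ω * mvfderiv I ψ x Φ := by
    have := congrArg (fun v ↦ mvfderiv I ψ x v) hK
    simpa using this
  rw [hΦψ, mul_zero, add_zero] at h2
  rw [g.stressEnergy_apply, hTK, h2]
  ring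

/-- **Line target of card A (non-rotating branch).** In the telescope of `KerrOrBomb`
(Ricci-flat, connected horizon, globally hyperbolic carrier), if the h3 horizon Killing field is a
non-zero multiple of the stationary field `T` (non-rotating branch) and the hole is Killing-mode
stable (`IsKillingModeStable`, `Iff.rfl` with the mode clause inlined in `KerrOrBomb`), then `T` is
nowhere spacelike on the domain of outer communications ("strict stationarity up to null orbits";
Friedman monotonicity with both fluxes signed + modal upgrade).  Heusler 1996 Thm 8.2 then gives
staticity.  NOT claimed provable here — it is the statement the card's line must prove. -/
def NonRotatingStrictStationarity : Prop :=
  ∀ (𝓑 : StationaryAFBlackHole.{0}) [𝓑.metric.HasLeviCivita],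
    𝓑.metric.toPseudoRiemannianMetric.IsRicciFlat → IsConnected 𝓑.horizon →
    𝓑.metric.IsGloballyHyperbolic 𝓑.timeOrientation →
    (∃ (c κ : ℝ), c ≠ 0 ∧ κ ≠ 0 ∧
      (∀ p ∈ 𝓑.horizon, 𝓑.killing p ≠ 0) ∧
      (∀ γ : ℝ → 𝓑.carrier, IsMIntegralCurve γ (fun x ↦ c • 𝓑.killing x) →
        γ 0 ∈ 𝓑.horizon → ∀ t, γ t ∈ 𝓑.horizon) ∧
      ∀ p ∈ 𝓑.horizon, 𝓑.metric.leviCivita (fun x ↦ c • 𝓑.killing x) p (c • 𝓑.killing p) =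
        κ • (c • 𝓑.killing p)) →
    𝓑.IsKillingModeStable →
    ∀ x ∈ 𝓑.doc, 𝓑.metric.val x (𝓑.killing x) (𝓑.killing x) ≤ 0

end CardA

/-! ## Card B — averaged-time Poincaré–Bendixson -/

/-- **First lemma of card B: a `U(1)`-invariant Cauchy hypersurface.** On a globally hyperbolic
carrier with an axisymmetric Killing field `Y` (complete, all integral curves `2π`-periodic) there
is a Cauchy hypersurface saturated by the orbits of `Y` (average a Bernal–Sánchez Cauchy time
function over the compact `U(1)`-flow: the average is again a Cauchy time function, its level sets
are `Y`-invariant).  This is the only input of the Chruściel–Costa structure theorem that the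
Poincaré–Bendixson lamination argument (CC08 Thm 5.6, Case III) uses besides flow-compactness. -/
def AveragedCauchyHypersurface : Prop :=
  ∀ (𝓑 : StationaryAFBlackHole.{0}) [𝓑.metric.HasLeviCivita]
    (Y : Π x : 𝓑.carrier, TangentSpace (𝓡 4) x),
    𝓑.metric.IsGloballyHyperbolic 𝓑.timeOrientation →
    𝓑.toSpacetime.IsAxisymmetricKilling Y →
    ∃ S : Set 𝓑.carrier, 𝓑.metric.IsCauchyHypersurface 𝓑.timeOrientation S ∧
      ∀ γ : ℝ → 𝓑.carrier, IsMIntegralCurve γ Y → γ 0 ∈ S → ∀ t, γ t ∈ S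

/-! ## Card C — periodicity from the collar -/

/-- **First lemma of card C: commuting Killing fields preserve each other's norm.** If `Z` and
`K` are Killing and `[Z, K] = 0` then `Z · g(K, K) = 0` everywhere
(`Z g(K,K) = 2 g(∇_Z K, K) = 2 g([Z,K] + ∇_K Z, K) = 2 g([Z,K], K)` by torsion-freeness and the
Killing equation of `Z` at `(K, K)`).  Hence `Z := K − T` is tangent to every level set
`{g(K,K) = −ε}` of the collar and descends to the `K`-quotient.  O'Neill 1983 Ch. 9 Prop. 9.25;
Wald (C.3.1). -/
def CommutingKillingPreservesNorm : Prop :=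
  ∀ (𝓑 : StationaryAFBlackHole.{0}) [𝓑.metric.HasLeviCivita]
    (Z K : Π x : 𝓑.carrier, TangentSpace (𝓡 4) x),
    𝓑.metric.IsKillingField Z → 𝓑.metric.IsKillingField K →
    (∀ x, VectorField.mlieBracket (𝓡 4) Z K x = 0) →
    ∀ x, mfderiv (𝓡 4) 𝓘(ℝ, ℝ) (fun y ↦ 𝓑.metric.val y (K y) (K y)) x (Z x) = 0

/-- **The residue of card C (and of card B): flow-compactness of a collar level set.** The
`−ε`-level set of `g(K, K)` inside the domain of outer communications is contained in the
`K`-orbit of a compact subset of the d.o.c. (true on every presentation of Kerr, `0 < ε` small: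
the level set is `ℝ × S²` near the horizon plus `ℝ × S²` near the light surface). -/
def CollarLevelFlowCompact (𝓑 : StationaryAFBlackHole.{0})
    (K : Π x : 𝓑.carrier, TangentSpace (𝓡 4) x) (ε : ℝ) : Prop :=
  ∃ C : Set 𝓑.carrier, IsCompact C ∧ C ⊆ 𝓑.doc ∧
    {x ∈ 𝓑.doc | 𝓑.metric.val x (K x) (K x) = -ε} ⊆ stationaryOrbit K C

/-- **Line target of card C.** In the telescope of `KerrOrBomb`, for the global horizon Killing
field `K` of h3 commuting with `T`, NOT a multiple of `T` at some horizon point (rotating branch),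
flow-compactness of one timelike collar level set forces a constant-coefficient combination
`α • K − T` to generate a PERIODIC flow on the domain of outer communications — the `U(1)` of the
Chruściel–Costa endgame — with no positive-mass theorem, no complete slice and no analyticity:
the period is read off the compact isometry group (Myers–Steenrod) of the Riemannian quotient
`{g(K,K) = −ε} / K`.  NOT claimed provable here — it is the statement the card's line must prove. -/
def PeriodicityFromCollar : Prop :=
  ∀ (𝓑 : StationaryAFBlackHole.{0}) [𝓑.metric.HasLeviCivita],
    𝓑.metric.toPseudoRiemannianMetric.IsRicciFlat → IsConnected 𝓑.horizon →
    𝓑.metric.IsGloballyHyperbolic 𝓑.timeOrientation →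
    ∀ (K : Π x : 𝓑.carrier, TangentSpace (𝓡 4) x) (κ : ℝ), κ ≠ 0 →
      𝓑.metric.IsKillingField K →
      (∀ p ∈ 𝓑.horizon, K p ≠ 0) →
      (∀ γ : ℝ → 𝓑.carrier, IsMIntegralCurve γ K → γ 0 ∈ 𝓑.horizon → ∀ t, γ t ∈ 𝓑.horizon) →
      (∀ p ∈ 𝓑.horizon, 𝓑.metric.leviCivita K p (K p) = κ • K p) →
      (∀ x, VectorField.mlieBracket (𝓡 4) 𝓑.killing K x = 0) →
      (∃ p ∈ 𝓑.horizon, ∀ c : ℝ, K p ≠ c • 𝓑.killing p) →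
      (∃ ε : ℝ, 0 < ε ∧ CollarLevelFlowCompact 𝓑 K ε ∧
        {x ∈ 𝓑.doc | 𝓑.metric.val x (K x) (K x) = -ε}.Nonempty) →
      ∃ (α P : ℝ), 0 < P ∧
        ∀ γ : ℝ → 𝓑.carrier, IsMIntegralCurve γ (fun x ↦ α • K x - 𝓑.killing x) →
          γ 0 ∈ 𝓑.doc → Function.Periodic γ P

end Summit.FinalStateConjecture.FinalStateConjecture.Cruxes.KerrOrBomb.Ideator2

end

namespace Summit.FinalStateConjecture.FinalStateConjecture.Cruxes.KerrOrBomb.Ideator2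

open Set Literature.Geometry.Lorentzian
open scoped Manifold ContDiff Topology

/-- **Card C's First lemma, `mvfderiv` form, PROVED.** For Killing fields `Z`, `K` with
`[Z, K] = 0`: `Z · g(K,K) = 2 g(∇_Z K, K) = 2 g(∇_K Z + [Z,K], K) = 2 g(∇_K Z, K) = 0`
(metric compatibility via `IsKillingField.mvfderiv_val_self_apply`, torsion-freeness of the
Levi-Civita connection, Killing equation of `Z` at `(K, K)`). -/
theorem commutingKilling_mvfderiv_normSq_eq_zero (𝓑 : StationaryAFBlackHole.{0})
    [𝓑.metric.HasLeviCivita] (Z K : Π x : 𝓑.carrier, TangentSpace (𝓡 4) x)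
    (hZ : 𝓑.metric.IsKillingField Z) (hK : 𝓑.metric.IsKillingField K)
    (hcomm : ∀ x, VectorField.mlieBracket (𝓡 4) Z K x = 0) (x : 𝓑.carrier) :
    mvfderiv (𝓡 4) (fun y ↦ 𝓑.metric.val y (K y) (K y)) x (Z x) = 0 := by
  have h1 := hK.mvfderiv_val_self_apply x (Z x)
  have hLC : 𝓑.metric.toPseudoRiemannianMetric.IsLeviCivita 𝓑.metric.leviCivita :=
    PseudoRiemannianMetric.isLeviCivita_leviCivita_holds
  have htor := (CovariantDerivative.torsion_eq_zero_iff 𝓑.metric.leviCivita).mp hLC.1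
    (hZ.mdifferentiableAt x) (hK.mdifferentiableAt x)
  rw [hcomm x, sub_eq_zero] at htor
  have h2 := hZ.val_leviCivita_add x (K x) (K x)
  rw [𝓑.metric.toPseudoRiemannianMetric.symm x (K x) (𝓑.metric.leviCivita Z x (K x))] at h2
  rw [h1, htor]
  linarith

end Summit.FinalStateConjecture.FinalStateConjecture.Cruxes.KerrOrBomb.Ideator2
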